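import Literature.AnabelianGeometry.EtaleTheta.Discharge.Sec3Cor38CriterionToy
import Literature.AlgebraicGeometry.Frobenioids.ArchimedeanPointBaseProp35
import HarnessLib

/-!
# [EtTh] Corollary 3.8 (i) AS TYPED is not a theorem of the typed Def. 3.3/3.6 data: a kernel countermodel
# (two tempered Frobenioids with the SAME model category and different base-field-theoretic hulls)

Mochizuki, *The étale theta function …*, Publ. RIMS **45** (2009), Cor. 3.8 (i), PDF pp. 80–81
[cite: MochizukiEtTh2009, Cor 3.8 p.80]: "Suppose, for `i = 1, 2`, that the base category `D_i` of `C_i` is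
Frobenius-slim. Then `Ψ` preserves the base-field-theoretic morphisms."  Its printed proof (p.81) rests on the
DATA of Def. 3.3 (iii)/3.6 (i): "`ℝ·Φ₀^cnst = ℝ·div(ϖ)`" is the real LINE through the EFFECTIVE divisor of a
uniformiser (Prop. 3.4 (ii), p.74), whence the bracketed consequence of Def. 3.6 (ii)(b) (p.77).

abc-iut cell, layer L2, seat abc-iut-w6-d039 (node `EtTh:Cor3.8(i)`; FACT-LIST row F-0740 `Cor38_i`, closure verdict).
CONSISTENCY / NECESSITY WITNESS (class (b) toy, companion of abc-iut-w5-d124's `Sec3Cor38CriterionToy.lean` p425444,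
which showed that the printed ROUTE — row C38-L05 — fails over the typed interface).  Here the typed STATEMENT fails:

* `Cor38ToyPair.C j k …` — for `{j, k} = {R, S}`, an inhabitant of the typed stack `DivisorMonoids` /
  `RealifiedDivisorMonoids` / `TemperedFrobenioid` over the trivial vocabularies (`TemperedFrobenioidToy.lean`) with
  `D = D₀ =` the one-morphism category, `Φ₀ = Φ^{ℝ-log} = Φ = ℤ_{≥0}⁴ = ⟨P, Q, R, S⟩`, `B₀^Λ = F₀^Λ = ℤ·b₀`,
  `div(b₀) = P − Q` (so Def. 3.6 (ii)(b) AS TYPED holds: `P ≠ Q`), and `ℝ·Φ₀^cnst := {g | g_P + g_Q = 0, g_j = 0}`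
  — a root-closed subgroup containing `div(F₀^Λ)`, with `Φ^{bs-fld} = Φ ∩ ℝ·Φ₀^cnst = ℤ_{≥0}·k` MONOPRIME, as the
  typed fields demand.  The two structures `C₁ := C S R` and `C₂ := C R S` differ ONLY in the field `cnstR`, which
  the model category `ModelFrobenioid Φ B (B → Φ^gp)` ([FrdI] Thm. 5.2 (i)) does not read: `C₁.category` and
  `C₂.category` are the same category, and `Ψ := 𝟭` is an equivalence with `D₁ = D₂` of FSMFF-type, `Φ_i`
  non-dilating — a `Cor38Hyp C₁ C₂` (`Cor38ToyPair.hyp`);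
* `Cor38ToyPair.not_preservesBaseFieldTheoretic` — the pre-step `φ : (•, 0) → (•, R)` with zero divisor `R` is
  base-field-theoretic in `C₁` (`R ∈ Φ^{bs-fld}_1 = ℤ_{≥0}·R`) but `Ψ φ = φ` is not in `C₂` (`R ∉ Φ^{bs-fld}_2 = ℤ_{≥0}·S`);
* **`Cor38ToyPair.not_cor38_i`** — the one-morphism base being (slim, hence) Frobenius-slim:
  `¬ Cor38_i (fun E _ => IsFrobeniusSlim E) hyp`; and **`Cor38ToyPair.not_forall_cor38_i`** — the universal closure of
  abc-iut-L2-t3's typed `Cor38_i` at its intended parameter (FACT-LIST F-0740) is REFUTED in the kernel.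

WHY four primes: with `Φ = ℤ_{≥0}³` and `div(b₀) = P − Q` the only subgroup `ℝ·Φ₀^cnst ∋ P − Q` meeting `Φ` in a
monoprime submonoid is `{g_P + g_Q = 0}` (the supporting planes of the orthant through `P − Q`), so no second structure
exists there; a fourth prime frees the choice of the base-field-theoretic ray.
READING (cell vocabulary): the countermodel violates print's "`ℝ·Φ₀^cnst` is the LINE `ℝ·div(ϖ)`, `div(ϖ)` effective"
(GAP-LEDGER G-w5d124-2, binders `hLine`/`hNZ` of `bsFldPreStepLimitCriterion_of(_line)`): that printed property of the
Def. 3.6 (i) data is therefore necessary for the typed STATEMENT of Cor. 3.8 (i), not only for its printed route; the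
instance form of Cor. 3.8 (i) GIVEN those binders is the tree theorem `Cor38Hyp.cor38_i_of_thm34ii` (p430168).
HONEST FRAMING: a countermodel to a TYPED READING over under-specified interfaces; it refutes nothing in [EtTh]
(refereed pre-IUT material) and bears in no way on [IUTchIII] Cor. 3.12.
-/

noncomputable section

namespace Literature.AnabelianGeometry.EtaleTheta

open CategoryTheory Opposite Literature.AlgebraicGeometry.Frobenioids

namespace Cor38ToyPair

/-! ### §1 The monoid `ℤ_{≥0}⁴ = ⟨P, Q, R, S⟩`, its coordinate characters, and the divisor `P − Q` -/

/-- The divisor monoid `ℤ_{≥0}⁴` (multiplicative notation; L1 `PiNat`). [cite: MochizukiEtTh2009, Def 3.3 p.73] -/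
abbrev M : Type := Multiplicative (Fin 4 → ℕ)

/-- The four primes `P = e 0`, `Q = e 1`, `R = e 2`, `S = e 3`. [cite: MochizukiEtTh2009, Def 3.3 p.73] -/
def e (j : Fin 4) : M := PiNat.single j 1

/-- The `j`-th coordinate character `(ℤ_{≥0}⁴)^gp → ℤ`. [cite: MochizukiEtTh2009, Def 3.6 p.76] -/
def π (j : Fin 4) : Algebra.GrothendieckGroup M →* Multiplicative ℤ :=
  Algebra.GrothendieckGroup.lift
    (((Nat.castAddMonoidHom ℤ).comp (Pi.evalAddMonoidHom (fun _ : Fin 4 => ℕ) j)).toMultiplicative)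

/-- `π j` on `of f` is the coordinate `f_j`. [cite: MochizukiEtTh2009, Def 3.6 p.76] -/
theorem π_of (j : Fin 4) (f : M) :
    π j (Algebra.GrothendieckGroup.of f) = Multiplicative.ofAdd ((Multiplicative.toAdd f j : ℕ) : ℤ) := by
  have h := Algebra.GrothendieckGroup.lift.symm_apply_apply
    (((Nat.castAddMonoidHom ℤ).comp (Pi.evalAddMonoidHom (fun _ : Fin 4 => ℕ) j)).toMultiplicative)
  rw [Algebra.GrothendieckGroup.lift_symm_apply] at h
  exact DFunLike.congr_fun h f

/-- `π j (e i) = δ_{ij}` (additively). [cite: MochizukiEtTh2009, Def 3.6 p.76] -/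
theorem π_e (j i : Fin 4) :
    π j (Algebra.GrothendieckGroup.of (e i)) = Multiplicative.ofAdd (if j = i then (1 : ℤ) else 0) := by
  rw [π_of]
  congr 1
  by_cases h : j = i
  · subst h; simp [e, PiNat.single]
  · rw [if_neg h]; simp [e, PiNat.single, Pi.single_eq_of_ne h]

/-- The character `g ↦ g_P + g_Q` ("the constant-line functional"). [cite: MochizukiEtTh2009, Def 3.6 p.76] -/
def ψ : Algebra.GrothendieckGroup M →* Multiplicative ℤ := π 0 * π 1

/-- `ψ` on `of f`. [cite: MochizukiEtTh2009, Def 3.6 p.76] -/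
theorem ψ_of (f : M) : ψ (Algebra.GrothendieckGroup.of f) =
    Multiplicative.ofAdd (((Multiplicative.toAdd f 0 : ℕ) : ℤ) + ((Multiplicative.toAdd f 1 : ℕ) : ℤ)) := by
  rw [ψ, MonoidHom.mul_apply, π_of, π_of, ← ofAdd_add]

/-- The divisor `P − Q` of the "uniformiser" `b₀`. [cite: MochizukiEtTh2009, Def 3.3 p.73] -/
def g₀ : Algebra.GrothendieckGroup M := Algebra.GrothendieckGroup.of (e 0) / Algebra.GrothendieckGroup.of (e 1)

/-- `ψ(P − Q) = 0`. [cite: MochizukiEtTh2009, Def 3.6 p.76] -/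
theorem ψ_g₀ : ψ g₀ = 1 := by
  rw [g₀, map_div, ψ, MonoidHom.mul_apply, MonoidHom.mul_apply, π_e, π_e, π_e, π_e]
  simp

/-- `π_j(P − Q) = 0` for `j ∉ {P, Q}`. [cite: MochizukiEtTh2009, Def 3.6 p.76] -/
theorem π_g₀ {j : Fin 4} (hj0 : j ≠ 0) (hj1 : j ≠ 1) : π j g₀ = 1 := by
  rw [g₀, map_div, π_e, π_e, if_neg hj0, if_neg hj1, div_self']

/-- `div : ℤ → (ℤ_{≥0}⁴)^gp`, `n ↦ n·(P − Q)`. [cite: MochizukiEtTh2009, Def 3.3 p.73] -/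
def divHom : Multiplicative ℤ →* Algebra.GrothendieckGroup M := zpowersHom _ g₀

/-- `divHom 1 = P − Q`. [cite: MochizukiEtTh2009, Def 3.3 p.73] -/
theorem divHom_ofAdd_one : divHom (Multiplicative.ofAdd 1) = g₀ := by
  rw [divHom, zpowersHom_apply, toAdd_ofAdd, zpow_one]

/-- A character killing `P − Q` kills every divisor of a "rational function". [cite: MochizukiEtTh2009, Def 3.6 p.76] -/
theorem apply_divHom_eq_one {χ : Algebra.GrothendieckGroup M →* Multiplicative ℤ} (hχ : χ g₀ = 1)
    (b : Multiplicative ℤ) : χ (divHom b) = 1 := by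
  rw [divHom, zpowersHom_apply, map_zpow, hχ, one_zpow]

/-- Kernels of `ℤ`-valued characters are root-closed. [folklore] -/
private theorem mem_ker_of_pow_mem_ker (χ : Algebra.GrothendieckGroup M →* Multiplicative ℤ)
    (g : Algebra.GrothendieckGroup M) (n : ℕ+) (hg : g ^ (n : ℕ) ∈ χ.ker) : g ∈ χ.ker := by
  have hg' : χ g ^ (n : ℕ) = 1 := by rw [← map_pow]; exact hg
  have h : (n : ℕ) • Multiplicative.toAdd (χ g) = 0 := by
    have := congrArg Multiplicative.toAdd hg'
    rwa [toAdd_pow, toAdd_one] at this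
  show χ g = 1
  rcases smul_eq_zero.mp h with h | h
  · exact absurd h n.ne_zero
  · exact congrArg Multiplicative.ofAdd h

/-- `gpMap id = id`, pointwise. [folklore] -/
private theorem gpMap_id_apply {N : Type} [CommMonoid N] (x : Algebra.GrothendieckGroup N) :
    gpMap (MonoidHom.id N) x = x :=
  DFunLike.congr_fun (Literature.AlgebraicGeometry.Frobenioids.gpMap_id (M := N)) x

/-! ### §2 The typed data; the constant subgroup is a PARAMETER `{g_P + g_Q = 0, g_j = 0}` -/

/-- "`ℝ·Φ₀^cnst`" of the model: the root-closed subgroup `{g | g_P + g_Q = 0, g_j = 0}` of `(ℤ_{≥0}⁴)^gp`.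
[cite: MochizukiEtTh2009, Def 3.6 p.76] -/
def cnstSub (j : Fin 4) : Subgroup (Algebra.GrothendieckGroup M) := ψ.ker ⊓ (π j).ker

/-- Def. 3.3 (iii) data: `Φ₀ = ℤ_{≥0}⁴`, `B₀ = ℤ`, `div₀ = (n ↦ n·(P − Q))`, `F₀ = B₀`, nothing cuspidal, over the
one-object base category (shared by both structures). [cite: MochizukiEtTh2009, Def 3.3 p.73] -/
def divisorMonoids : DivisorMonoids.{0, 0, 0} (Discrete PUnit.{1}) where
  Φ₀ := (Functor.const _).obj (CommMonCat.of M)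
  B₀ := (Functor.const _).obj (CommMonCat.of (Multiplicative ℤ))
  isUnit_B₀ _ b := by
    change IsUnit (M := Multiplicative ℤ) b
    exact Group.isUnit _
  div₀ _ := divHom
  div₀_natural _ b := (gpMap_id_apply (divHom b)).symm
  F₀ _ := ⊤
  F₀_map _ _ _ := trivial
  ncsp₀ _ := ⊤
  csp₀ _ := ⊥
  ncsp₀_map _ _ _ := trivial
  csp₀_map _ x hx := by
    rw [Submonoid.mem_bot] at hx ⊢
    rw [hx, map_one]
  existsUnique_ncsp_csp _ x := by
    refine ⟨(⟨x, trivial⟩, ⟨1, Submonoid.mem_bot.mpr rfl⟩), mul_one x, ?_⟩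
    rintro ⟨a, c⟩ h
    have hc : c.1 = 1 := Submonoid.mem_bot.mp c.2
    have ha : a.1 = x := by
      have h' : a.1 * c.1 = x := h
      rwa [hc, mul_one] at h'
    exact Prod.ext (Subtype.ext ha) (Subtype.ext hc)

/-- Def. 3.6 (i) data (`Λ = ℤ`, `Φ₀^ℝ = Φ₀`, `B₀^Λ = F₀^Λ = B₀`) with `ℝ·Φ₀^cnst := {g_P + g_Q = 0, g_j = 0}` for a prime
`j ∉ {P, Q}` — every typed field holds (root-closed subgroup containing `div(F₀^Λ) = ℤ·(P − Q)` and the image of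
`Φ₀^cnst`). [cite: MochizukiEtTh2009, Def 3.6 p.76] -/
def realified (j : Fin 4) (hj0 : j ≠ 0) (hj1 : j ≠ 1) :
    RealifiedDivisorMonoids (D₀ := Discrete PUnit.{1}) Toy.monoidVocab where
  toDivisorMonoids := divisorMonoids
  Λ := MonoidType.Z
  ΦR := (Functor.const _).obj (CommMonCat.of M)
  toR _ := MonoidHom.id _
  toR_natural _ _ := rfl
  isRealification _ := trivial
  BΛ := (Functor.const _).obj (CommMonCat.of (Multiplicative ℤ))
  isUnit_BΛ _ b := by
    change IsUnit (M := Multiplicative ℤ) b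
    exact Group.isUnit _
  divΛ _ := divHom
  divΛ_natural _ b := (gpMap_id_apply (divHom b)).symm
  FΛ _ := ⊤
  FΛ_map _ _ _ := trivial
  cnstR _ := cnstSub j
  cnstR_map _ x hx := by
    show gpMap (MonoidHom.id M) x ∈ cnstSub j
    rw [gpMap_id_apply]
    exact hx
  divΛ_mem_cnstR _ b _ :=
    ⟨show ψ (divHom b) = 1 from apply_divHom_eq_one ψ_g₀ b,
      show π j (divHom b) = 1 from apply_divHom_eq_one (π_g₀ hj0 hj1) b⟩
  cnstR_root _ g n hg := ⟨mem_ker_of_pow_mem_ker ψ g n hg.1, mem_ker_of_pow_mem_ker (π j) g n hg.2⟩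
  cnst_le_cnstR _ b _ := by
    show gpMap (MonoidHom.id M) (divHom b) ∈ cnstSub j
    rw [gpMap_id_apply]
    exact ⟨show ψ (divHom b) = 1 from apply_divHom_eq_one ψ_g₀ b,
      show π j (divHom b) = 1 from apply_divHom_eq_one (π_g₀ hj0 hj1) b⟩
  ncspR _ := ⊤
  cspR _ := ⊥
  toR_ncsp _ _ _ := trivial
  toR_csp _ _ hx := hx

/-- For `{P, Q, j, k}` the four primes, the base-field-theoretic submonoid `ℤ_{≥0}⁴ ∩ {g_P + g_Q = 0, g_j = 0}` is
`ℤ_{≥0}·k ≅ ℤ_{≥0}` via `f ↦ f_k` (so it is monoprime). [cite: MochizukiEtTh2009, Def 3.6 p.77] -/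
def bsFldEquiv (j k : Fin 4) (hk0 : k ≠ 0) (hk1 : k ≠ 1) (hkj : k ≠ j)
    (hcov : ∀ i : Fin 4, i = 0 ∨ i = 1 ∨ i = j ∨ i = k) :
    ↥((⊤ : Submonoid M) ⊓ (cnstSub j).toSubmonoid.comap Algebra.GrothendieckGroup.of) ≃* Multiplicative ℕ where
  toFun f := Multiplicative.ofAdd (Multiplicative.toAdd f.1 k)
  invFun n := ⟨PiNat.single k (Multiplicative.toAdd n), Submonoid.mem_top _, by
    change Algebra.GrothendieckGroup.of (PiNat.single k (Multiplicative.toAdd n) : M) ∈ cnstSub j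
    refine ⟨?_, ?_⟩
    · show ψ _ = 1
      rw [ψ_of]
      simp [PiNat.single, Pi.single_eq_of_ne hk0.symm, Pi.single_eq_of_ne hk1.symm]
    · show π j _ = 1
      rw [π_of]
      simp [PiNat.single, Pi.single_eq_of_ne hkj.symm]⟩
  left_inv f := by
    obtain ⟨f, -, hf⟩ := f
    apply Subtype.ext
    change (PiNat.single k (Multiplicative.toAdd f k) : M) = f
    obtain ⟨hψ, hπ⟩ := hf
    have hψ' : ψ (Algebra.GrothendieckGroup.of f) = 1 := hψ
    have hπ' : π j (Algebra.GrothendieckGroup.of f) = 1 := hπ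
    rw [ψ_of] at hψ'
    rw [π_of] at hπ'
    have h01 : ((Multiplicative.toAdd f 0 : ℕ) : ℤ) + ((Multiplicative.toAdd f 1 : ℕ) : ℤ) = 0 :=
      Multiplicative.ofAdd.injective hψ'
    have hj' : ((Multiplicative.toAdd f j : ℕ) : ℤ) = 0 := Multiplicative.ofAdd.injective hπ'
    have h0 : Multiplicative.toAdd f 0 = 0 := by omega
    have h1 : Multiplicative.toAdd f 1 = 0 := by omega
    have hj : Multiplicative.toAdd f j = 0 := by omega
    apply PiNat.ext
    intro i
    rcases hcov i with hi | hi | hi | hi <;> rw [hi]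
    · rw [PiNat.coeff_single_of_ne hk0.symm]; exact h0.symm
    · rw [PiNat.coeff_single_of_ne hk1.symm]; exact h1.symm
    · rw [PiNat.coeff_single_of_ne hkj.symm]; exact hj.symm
    · rw [PiNat.coeff_single_same]
  right_inv n := by simp [PiNat.single]
  map_mul' f g := by
    change Multiplicative.ofAdd (Multiplicative.toAdd (f.1 * g.1) k) = _
    rw [toAdd_mul, Pi.add_apply, ofAdd_add]

/-- **The typed tempered-Frobenioid interface is satisfied** by the data with constant subgroup
`{g_P + g_Q = 0, g_j = 0}` (`{P, Q, j, k}` the four primes): one-object base, `Φ = Φ^{ℝ-log} = ℤ_{≥0}⁴`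
(group-saturated), `Φ^{bs-fld} ≅ ℤ_{≥0}·k` monoprime (REAL `IsMonoprime`), and Def. 3.6 (ii)(b) AS TYPED: the constant `b₀`
has the nonzero divisor `P/Q`, `P ≠ Q ∈ Φ`. [cite: MochizukiEtTh2009, Def 3.6 p.77] -/
def C (j k : Fin 4) (hj0 : j ≠ 0) (hj1 : j ≠ 1) (hk0 : k ≠ 0) (hk1 : k ≠ 1) (hkj : k ≠ j)
    (hcov : ∀ i : Fin 4, i = 0 ∨ i = 1 ∨ i = j ∨ i = k) :
    TemperedFrobenioid (realified j hj0 hj1) (Discrete PUnit.{1}) Toy.catVocab where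
  isConnected := zigzag_isConnected fun j₁ j₂ => by rw [Subsingleton.elim j₁ j₂]
  isTotallyEpimorphic := ⟨fun f => ⟨fun _ _ _ => Subsingleton.elim _ _⟩⟩
  base := 𝟭 _
  Φ := ⟨fun _ => ⊤, fun _ _ _ => trivial⟩
  isGroupSaturated A := (isGroupSaturated_iff' _).2 fun _ _ _ _ _ _ => trivial
  isPerfFactorial _ := trivial
  isDivisorialOn := trivial
  isMonoprime_bsFld _ := IsMonoprime.ofZ ⟨⟨bsFldEquiv j k hk0 hk1 hkj hcov⟩⟩
  exists_FΛ_div_ne _ := ⟨(Multiplicative.ofAdd (1 : ℤ) : Multiplicative ℤ), trivial, e 0, trivial, e 1, trivial,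
    fun h => by
      have := congrArg (fun f : M => Multiplicative.toAdd f 0) h
      simp [e, PiNat.single] at this,
    divHom_ofAdd_one⟩

/-! ### §3 The pair: `C₁` with `Φ^{bs-fld} = ℤ_{≥0}·R`, `C₂` with `Φ^{bs-fld} = ℤ_{≥0}·S`, same category, `Ψ = 𝟭` -/

/-- `{P, Q, S, R}` are the four primes. [folklore] -/
private theorem cov32 : ∀ i : Fin 4, i = 0 ∨ i = 1 ∨ i = 3 ∨ i = 2 := by decide

/-- `{P, Q, R, S}` are the four primes. [folklore] -/
private theorem cov23 : ∀ i : Fin 4, i = 0 ∨ i = 1 ∨ i = 2 ∨ i = 3 := by decide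

/-- `C₁`: constant subgroup `{g_P + g_Q = 0, g_S = 0}`, so `Φ^{bs-fld}_1 = ℤ_{≥0}·R`. [cite: MochizukiEtTh2009, Def 3.6 p.77] -/
def C₁ : TemperedFrobenioid (realified 3 (by decide) (by decide)) (Discrete PUnit.{1}) Toy.catVocab :=
  C 3 2 (by decide) (by decide) (by decide) (by decide) (by decide) cov32

/-- `C₂`: constant subgroup `{g_P + g_Q = 0, g_R = 0}`, so `Φ^{bs-fld}_2 = ℤ_{≥0}·S`. [cite: MochizukiEtTh2009, Def 3.6 p.77] -/
def C₂ : TemperedFrobenioid (realified 2 (by decide) (by decide)) (Discrete PUnit.{1}) Toy.catVocab :=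
  C 2 3 (by decide) (by decide) (by decide) (by decide) (by decide) cov23

/-- The one-morphism base category is Frobenius-slim ([FrdI] Def. 3.1 (i): slim ⇒ Frobenius-slim; L1).
[cite: MochizukiFrdI2008, Def. 3.1 (i) p.56] -/
theorem isFrobeniusSlim_pt : IsFrobeniusSlim (Discrete PUnit.{1}) := isSlim_discretePUnit.isFrobeniusSlim

/-- **The standing hypotheses of Cor. 3.8 hold for the pair** with `Ψ := 𝟭` — the model category
`ModelFrobenioid Φ B (B → Φ^gp)` of [FrdI] Thm. 5.2 (i) does not read the field `cnstR`, so `C₁.category` and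
`C₂.category` are one and the same category; `D₁ = D₂` is of FSMFF-type (L1 `ArchFrd.isOfFSMFFType_discretePUnit`) and "`Φ_i` non-dilating" is the trivial
vocabulary predicate. [cite: MochizukiEtTh2009, Cor 3.8 p.80] -/
def hyp : Cor38Hyp C₁ C₂ where
  Ψ := CategoryTheory.Equivalence.refl
  fsmff := ⟨ArchFrd.isOfFSMFFType_discretePUnit, ArchFrd.isOfFSMFFType_discretePUnit⟩
  nonDilating := ⟨fun _ _ => trivial, fun _ _ => trivial⟩

/-! ### §4 The pre-step with zero divisor `R` is base-field-theoretic in `C₁` but not in `C₂` -/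

/-- The base point. [cite: MochizukiEtTh2009, Def 3.6 p.77] -/
abbrev pt : Discrete PUnit.{1} := ⟨PUnit.unit⟩

/-- The effective divisor `R ∈ Φ(•)`. [cite: MochizukiEtTh2009, Def 3.6 p.77] -/
def R : C₁.divisorMonoid.obj (op pt) := (⟨e 2, Submonoid.mem_top _⟩ : (⊤ : Submonoid M))

/-- The Frobenius-trivial object `A₀ = (•, 0)` of the common model category. [cite: MochizukiFrdI2008, Thm. 5.2 (i) p.100] -/
abbrev A₀ : C₁.category := ⟨pt, 1⟩

/-- The object `B₀ = (•, R)`. [cite: MochizukiFrdI2008, Thm. 5.2 (i) p.100] -/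
abbrev B₀ : C₁.category := ⟨pt, Algebra.GrothendieckGroup.of R⟩

/-- The pre-step `φ = (1, id, R, 1) : (•, 0) → (•, R)` with zero divisor `R`. [cite: MochizukiFrdI2008, Thm. 5.2 (i) p.100] -/
def φ : A₀ ⟶ B₀ where
  degFr := 1
  base := 𝟙 pt
  div := R
  unit := 1
  rel := by
    show (1 : Algebra.GrothendieckGroup (C₁.divisorMonoid.obj (op pt))) ^ ((1 : ℕ+) : ℕ) *
        Algebra.GrothendieckGroup.of R =
      pullGp C₁.divisorMonoid (𝟙 pt) (Algebra.GrothendieckGroup.of R) *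
        divB C₁.divisorMonoid C₁.ratFnFunctor C₁.divBNatTrans (op pt) 1
    rw [one_pow, one_mul, map_one, mul_one, pullGp_id]

/-- `φ` is a pre-step of `C₁`. [cite: MochizukiFrdI2008, Def. 1.2 (iii) p.22] -/
theorem isPreStep_φ : C₁.opsData.IsPreStep φ :=
  ⟨rfl, by change IsIso (𝟙 pt); infer_instance⟩

/-- `φ` is base-field-theoretic in `C₁`: `R` lies in `{g_P + g_Q = 0, g_S = 0}`. [cite: MochizukiEtTh2009, Def 3.6 p.78] -/
theorem isBaseFieldTheoretic₁_φ : C₁.IsBaseFieldTheoretic φ := by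
  refine ⟨trivial, ?_⟩
  change Algebra.GrothendieckGroup.of (e 2) ∈ cnstSub 3
  refine ⟨?_, ?_⟩
  · show ψ _ = 1
    rw [ψ, MonoidHom.mul_apply, π_e, π_e]; decide
  · show π 3 _ = 1
    rw [π_e]; decide

/-- `Ψ φ = φ` is NOT base-field-theoretic in `C₂`: `R ∉ {g_P + g_Q = 0, g_R = 0}`. [cite: MochizukiEtTh2009, Def 3.6 p.78] -/
theorem not_isBaseFieldTheoretic₂_φ : ¬ C₂.IsBaseFieldTheoretic (hyp.Ψ.functor.map φ) := by
  rintro ⟨-, hR⟩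
  have h2 : Algebra.GrothendieckGroup.of (e 2) ∈ (π 2).ker := (Subgroup.mem_inf.mp hR).2
  rw [MonoidHom.mem_ker, π_e, if_pos rfl] at h2
  exact absurd (Multiplicative.ofAdd.injective (h2.trans ofAdd_zero.symm)) one_ne_zero

/-- **`Ψ = 𝟭` does NOT preserve the base-field-theoretic morphisms** between the two typed tempered Frobenioids.
[cite: MochizukiEtTh2009, Cor 3.8 p.80] -/
theorem not_preservesBaseFieldTheoretic : ¬ PreservesBaseFieldTheoretic hyp := fun H =>
  not_isBaseFieldTheoretic₂_φ ((H φ).1 isBaseFieldTheoretic₁_φ)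

/-! ### §5 The verdict -/

/-- **[EtTh] Cor. 3.8 (i) AS TYPED (`Cor38_i` at its intended parameter `IsFrobeniusSlim`) FAILS for the pair**:
the bases are Frobenius-slim, `Ψ = 𝟭` satisfies `Cor38Hyp`, yet a base-field-theoretic pre-step of `C₁` is not
base-field-theoretic in `C₂`. [cite: MochizukiEtTh2009, Cor 3.8 p.80] -/
theorem not_cor38_i :
    ¬ Literature.AnabelianGeometry.EtaleTheta.Cor38_i
        (fun E _ => Literature.AlgebraicGeometry.Frobenioids.IsFrobeniusSlim E) hyp := fun H =>
  not_preservesBaseFieldTheoretic (H isFrobeniusSlim_pt isFrobeniusSlim_pt)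

/-- **The universal closure of the typed `Cor38_i` (cell FACT-LIST F-0740, at the intended parameter) is REFUTED**:
it is not the case that for all typed Def. 3.3/3.6 data over the trivial [FrdI] vocabularies and every `Cor38Hyp`,
`Ψ` preserves the base-field-theoretic morphisms when the bases are Frobenius-slim — the printed property
"`ℝ·Φ₀^cnst = ℝ·div(ϖ)`, `div(ϖ)` effective" of the Def. 3.6 (i) data (GAP-LEDGER G-w5d124-2) is not recorded by the
typed structure and is NECESSARY for the statement. [cite: MochizukiEtTh2009, Cor 3.8 p.80] -/
theorem not_forall_cor38_i :
    ¬ ∀ (T₁ T₂ : RealifiedDivisorMonoids (D₀ := Discrete PUnit.{1}) Toy.monoidVocab)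
        (C' : TemperedFrobenioid T₁ (Discrete PUnit.{1}) Toy.catVocab)
        (C'' : TemperedFrobenioid T₂ (Discrete PUnit.{1}) Toy.catVocab) (h : Cor38Hyp C' C''),
        Literature.AnabelianGeometry.EtaleTheta.Cor38_i
          (fun E _ => Literature.AlgebraicGeometry.Frobenioids.IsFrobeniusSlim E) h :=
  fun H => not_cor38_i (H _ _ C₁ C₂ hyp)

end Cor38ToyPair

end Literature.AnabelianGeometry.EtaleTheta
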